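import Summits.Ventures.PercRepro.C026TheoremC

/-!
# The factor-2 and Cauchy–Schwarz forms of C-026 (mine-3 dossier §12, S7–S9) (p5, gen 7)

mine-3 (15:37:31Z): on every graph with `n ≤ 7` (all `m`), `n = 8, m ≤ 13` and 20,400 random multigraphs,
the class form of C-026 holds with a FACTOR 2 and in Cauchy–Schwarz form:

* **S7 `TwoTimesIneq`**: `2·#(BAD ∩ bot) ≤ #ac|b + #bc|a` (the class form of `Q3½`:
  `P(a~b)·P(c iso) ≤ P(ab|c) + ½[P(ac|b) + P(bc|a)]`); it gives `(CF′)` at once (`card_botM_le_of_twoTimes`);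
* **S8 `FactorTwoDFree`**: `2·#KL ≤ #Kc + #Lc` (the D-free inequality with a factor 2 and without the
  `KLc₂` term; tight on `K_{3,k}`); **`starPrime_of_factorTwo`**: it implies `(★′)` — with Theorem B(d)
  `badM_of_o1_of_o2` (both offers ⇒ bad, so `Kc`, `Lc` and the offered bad configurations are disjoint);
* **S9 `CSIneq` / `CSResidualIneq`**: `#(BAD ∩ bot)² ≤ #ac|b · #bc|a` and `#KL² ≤ #Kc · #Lc`, each
  implying its factor-2 form by AM–GM (`twoTimes_of_cs`, `factorTwo_of_csResidual`);
* the bridges to C-026: `C026UpTo_of_twoTimes`, `C026UpTo_of_factorTwo`, `C026UpTo_of_cs`.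
-/

namespace PercRepro

open Finset

namespace MultiGraph

section FactorTwo

variable {V E : Type*} (G : MultiGraph V E)

/-- **`Lc`**: `bot`, not bad, with the second offer. -/
def Lc (ω : Config E) (a b c : V) : Prop := G.IsBot ω a b c ∧ ¬ G.BadM ω a b c ∧ G.O2 ω a b c

/-- **Theorem B(d)**: both offers give a bad configuration (concatenate the walk `c ~ a` avoiding `L`
with the walk `c ~ b` avoiding `K`). -/
theorem badM_of_o1_of_o2 {ω : Config E} {a b c : V} (h1 : G.O1 ω a b c) (h2 : G.O2 ω a b c) :
    G.BadM ω a b c := by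
  have hbot := h1.1
  have w1 : G.HConnAvoid ω c (G.cluster ω b) c a := (G.cellAC_kSwapSealed_iff hbot).mp h1.2
  have w2 : G.HConnAvoid ω c (G.cluster ω a) c b := (G.cellBC_kSwapSealed_iff hbot).mp h2.2
  refine ⟨⟨hbot.2.1, hbot.2.2⟩, ?_⟩
  rw [G.conn_kSwap_iff_hConn]
  exact (G.hConn_symm (G.hConn_of_hConnAvoid w1)).trans (G.hConn_of_hConnAvoid w2)

/-- A `bot` configuration joining `a` and `b` in `δ(S)` is bad. -/
theorem badM_of_botM {ω : Config E} {a b c : V} (h : G.BotM ω a b c) : G.BadM ω a b c :=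
  ⟨⟨h.1.2.1, h.1.2.2⟩, h.2⟩

variable [Fintype E] [DecidableEq E]

open Classical in
/-- **S7**: `2·#(BAD ∩ bot) ≤ #ac|b + #bc|a` (the class form of `Q3½`). -/
def TwoTimesIneq (a b c : V) : Prop :=
  2 * (Finset.univ.filter fun ω : Config E => G.BotM ω a b c).card ≤
    (Finset.univ.filter fun ω : Config E => G.Conn ω a c ∧ ¬ G.Conn ω a b).card +
      (Finset.univ.filter fun ω : Config E => G.Conn ω b c ∧ ¬ G.Conn ω a b).card

open Classical in
/-- **S8**: `2·#KL ≤ #Kc + #Lc` (the D-free inequality with a factor 2, no `KLc₂` term). -/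
def FactorTwoDFree (a b c : V) : Prop :=
  2 * (Finset.univ.filter fun ω : Config E => G.KL ω a b c).card ≤
    (Finset.univ.filter fun ω : Config E => G.Kc ω a b c).card +
      (Finset.univ.filter fun ω : Config E => G.Lc ω a b c).card

open Classical in
/-- **S9**: `#(BAD ∩ bot)² ≤ #ac|b · #bc|a`. -/
def CSIneq (a b c : V) : Prop :=
  (Finset.univ.filter fun ω : Config E => G.BotM ω a b c).card ^ 2 ≤
    (Finset.univ.filter fun ω : Config E => G.Conn ω a c ∧ ¬ G.Conn ω a b).card *
      (Finset.univ.filter fun ω : Config E => G.Conn ω b c ∧ ¬ G.Conn ω a b).card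

open Classical in
/-- **S9, residual form**: `#KL² ≤ #Kc · #Lc`. -/
def CSResidualIneq (a b c : V) : Prop :=
  (Finset.univ.filter fun ω : Config E => G.KL ω a b c).card ^ 2 ≤
    (Finset.univ.filter fun ω : Config E => G.Kc ω a b c).card *
      (Finset.univ.filter fun ω : Config E => G.Lc ω a b c).card

omit G in
/-- AM–GM on naturals: `x² ≤ y·z` gives `2x ≤ y + z`. -/
theorem two_mul_le_of_sq_le {x y z : ℕ} (h : x ^ 2 ≤ y * z) : 2 * x ≤ y + z := by
  by_contra hcon
  push Not at hcon
  have h1 : (y + z) ^ 2 < (2 * x) ^ 2 := Nat.pow_lt_pow_left hcon (by norm_num)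
  have h2 : 4 * (y * z) ≤ (y + z) ^ 2 := by nlinarith [Nat.zero_le ((y - z) * (y - z)), sq_nonneg ((y : ℤ) - z)]
  nlinarith

open Classical in
/-- S7 gives `(CF′)`. -/
theorem card_botM_le_of_twoTimes {a b c : V} (h : G.TwoTimesIneq a b c) :
    (Finset.univ.filter fun ω : Config E => G.BotM ω a b c).card ≤
      (Finset.univ.filter fun ω : Config E => G.Conn ω a c ∧ ¬ G.Conn ω a b).card +
        (Finset.univ.filter fun ω : Config E => G.Conn ω b c ∧ ¬ G.Conn ω a b).card := by
  unfold TwoTimesIneq at h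
  omega

open Classical in
/-- S9 gives S7 (AM–GM). -/
theorem twoTimes_of_cs {a b c : V} (h : G.CSIneq a b c) : G.TwoTimesIneq a b c :=
  two_mul_le_of_sq_le h

open Classical in
/-- S9 (residual form) gives S8 (AM–GM). -/
theorem factorTwo_of_csResidual {a b c : V} (h : G.CSResidualIneq a b c) : G.FactorTwoDFree a b c :=
  two_mul_le_of_sq_le h

open Classical in
/-- **S8 gives `(★′)`**: `#{bot : a ~_H b avoiding c} ≤ #BotM = #KL + #{BotM ∧ (O1 ∨ O2)} ≤ #Kc + #Lc +
#{BotM ∧ (O1 ∨ O2)} ≤ #{bot : O1 ∨ O2}` (the last three sets are pairwise disjoint by Theorem B(d)). -/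
theorem starPrime_of_factorTwo {a b c : V} (h : G.FactorTwoDFree a b c) : G.StarPrimeIneq a b c := by
  unfold StarPrimeIneq
  unfold FactorTwoDFree at h
  -- (1) the `c`-free bad configurations are bad
  have h1 : (Finset.univ.filter fun ω : Config E => G.IsBot ω a b c ∧ G.HConnAvoid ω c {c} a b) ⊆
      Finset.univ.filter fun ω : Config E => G.BotM ω a b c := by
    intro ω hω
    simp only [Finset.mem_filter, Finset.mem_univ, true_and] at hω ⊢
    refine ⟨hω.1, ?_⟩
    rw [G.conn_kSwap_iff_hConn]
    exact G.hConn_of_hConnAvoid hω.2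
  -- (2) `BotM = KL ⊔ (BotM ∧ (O1 ∨ O2))`
  have h2 : (Finset.univ.filter fun ω : Config E => G.BotM ω a b c).card =
      (Finset.univ.filter fun ω : Config E => G.KL ω a b c).card +
        (Finset.univ.filter fun ω : Config E => G.BotM ω a b c ∧ (G.O1 ω a b c ∨ G.O2 ω a b c)).card := by
    rw [← Finset.card_union_of_disjoint]
    · congr 1
      ext ω
      simp only [Finset.mem_filter, Finset.mem_univ, true_and, Finset.mem_union, KL]
      tauto
    · rw [Finset.disjoint_left]
      intro ω hω hω'
      simp only [Finset.mem_filter, Finset.mem_univ, true_and] at hω hω'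
      rcases hω'.2 with h' | h'
      · exact hω.2.1 h'
      · exact hω.2.2 h'
  -- (3) `Kc ⊔ Lc ⊔ (BotM ∧ (O1 ∨ O2)) ⊆ {bot : O1 ∨ O2}`, pairwise disjoint
  have h3 : (Finset.univ.filter fun ω : Config E => G.Kc ω a b c).card +
      (Finset.univ.filter fun ω : Config E => G.Lc ω a b c).card +
        (Finset.univ.filter fun ω : Config E => G.BotM ω a b c ∧ (G.O1 ω a b c ∨ G.O2 ω a b c)).card ≤
      (Finset.univ.filter fun ω : Config E => G.IsBot ω a b c ∧ (G.O1 ω a b c ∨ G.O2 ω a b c)).card := by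
    rw [← Finset.card_union_of_disjoint, ← Finset.card_union_of_disjoint]
    · apply Finset.card_le_card
      intro ω hω
      simp only [Finset.mem_union, Finset.mem_filter, Finset.mem_univ, true_and] at hω ⊢
      rcases hω with (hω | hω) | hω
      · exact ⟨hω.1, Or.inl hω.2.2⟩
      · exact ⟨hω.1, Or.inr hω.2.2⟩
      · exact ⟨hω.1.1, hω.2⟩
    · rw [Finset.disjoint_left]
      intro ω hω hω'
      simp only [Finset.mem_union, Finset.mem_filter, Finset.mem_univ, true_and] at hω hω'
      rcases hω with hω | hω
      · exact hω.2.1 (G.badM_of_botM hω'.1)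
      · exact hω.2.1 (G.badM_of_botM hω'.1)
    · rw [Finset.disjoint_left]
      intro ω hω hω'
      simp only [Finset.mem_filter, Finset.mem_univ, true_and] at hω hω'
      exact hω.2.1 (G.badM_of_o1_of_o2 hω.2.2 hω'.2.2)
  have h4 := Finset.card_le_card h1
  omega

end FactorTwo

end MultiGraph

/-- **S7 on the simple graphs with ≤ N vertices and three distinct marks.** -/
def TwoTimesSimpleUpTo (N : ℕ) : Prop :=
  ∀ {V E : Type} [Fintype V] [Fintype E] [DecidableEq E], Fintype.card V ≤ N →
    ∀ (G : MultiGraph V E), G.IsSimple → ∀ a b c : V, a ≠ b → a ≠ c → b ≠ c → G.TwoTimesIneq a b c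

/-- **S8 on the simple graphs with ≤ N vertices and three distinct marks.** -/
def FactorTwoSimpleUpTo (N : ℕ) : Prop :=
  ∀ {V E : Type} [Fintype V] [Fintype E] [DecidableEq E], Fintype.card V ≤ N →
    ∀ (G : MultiGraph V E), G.IsSimple → ∀ a b c : V, a ≠ b → a ≠ c → b ≠ c → G.FactorTwoDFree a b c

/-- **S9 on the simple graphs with ≤ N vertices and three distinct marks.** -/
def CSSimpleUpTo (N : ℕ) : Prop :=
  ∀ {V E : Type} [Fintype V] [Fintype E] [DecidableEq E], Fintype.card V ≤ N →
    ∀ (G : MultiGraph V E), G.IsSimple → ∀ a b c : V, a ≠ b → a ≠ c → b ≠ c → G.CSIneq a b c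

/-- **C-026 from S7 (the factor-2 class form).** -/
theorem C026UpTo_of_twoTimes {N : ℕ} (h : TwoTimesSimpleUpTo N) : C026UpTo N := by
  refine C026UpTo_of_simpleInj ?_
  intro V E _ _ _ hV G hs m hm
  have hm' : m = ![m 0, m 1, m 2] := by
    funext i
    fin_cases i <;> rfl
  rw [hm', G.cubeSumQuad_kernel26_nonneg_iff_M]
  exact G.card_botM_le_of_twoTimes (h hV G hs (m 0) (m 1) (m 2) (fun h01 => absurd (hm h01) (by decide))
    (fun h02 => absurd (hm h02) (by decide)) (fun h12 => absurd (hm h12) (by decide)))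

/-- **C-026 from S8 (the factor-2 D-free form)**, through `(★′)`. -/
theorem C026UpTo_of_factorTwo {N : ℕ} (h : FactorTwoSimpleUpTo N) : C026UpTo N :=
  C026UpTo_of_starPrime fun hV G hs a b c hab hac hbc =>
    G.starPrime_of_factorTwo (h hV G hs a b c hab hac hbc)

/-- **C-026 from S9 (the Cauchy–Schwarz form).** -/
theorem C026UpTo_of_cs {N : ℕ} (h : CSSimpleUpTo N) : C026UpTo N :=
  C026UpTo_of_twoTimes fun hV G hs a b c hab hac hbc => G.twoTimes_of_cs (h hV G hs a b c hab hac hbc)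

end PercRepro
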